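import Literature.Computability.Complexity.ArthurMerlinBoards
import Literature.Computability.Complexity.ArthurMerlinCollapseProofs
import Literature.Computability.Complexity.HashBricks
import Literature.Computability.Complexity.ReductionsProofs
import HarnessLib

/-!
# Arthur–Merlin games with polynomially many moves are closed under Karp reductions

If `L₁ ≤ₚ L₂` and `L₂` has an Arthur–Merlin game with `n^c` moves (`AMRounds (fun n => n ^ c)`,
`ArthurMerlinGames.lean`), then `L₁` has one with `n^{c'}` moves, for some `c'`
(`AMRounds_pow_of_karpReducible`). With `ArthurMerlinPolyRoundsIP.lean` (`AM(n^c) ⊆ IP`) this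
places every language Karp-reducible to the target of a public-coin protocol in `IP` — the form in
which `PSPACE ⊆ IP` follows from the protocol for the `PSPACE`-complete `TQBF` (Arora–Barak 2009,
§8.3: "it suffices to show `TQBF ∈ IP[poly(n)]` because every `L ∈ PSPACE` is polytime reducible
to `TQBF`").

The simulation (standard; "the new referee acts in polynomial time, using the old referee as an
oracle", Babai–Moran 1988, §2.5): on input `x` of length `≥ 2` the new referee computes `y = f(x)`
and feeds the OLD referee the first `k = |y|^c` moves, each cut to the old move length `m(|y|)`
(`KarpSim.redF`; the extra moves and the extra bits are dummies: `gameValue_append_dummy`, and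
the parallel-play lemma `gameValue_parallel` on ONE board for the cut), so the value of the new
game on `x` is the value of the old game on `y` (`KarpSim.amValue_eq`); inputs of length `< 2`
(for which `|x|^{c'}` moves may be too few) are decided by table (`Brick.memListFn`). The
exponent `c'` absorbs the polynomial output length of `f` (`|f x|^c ≤ |x|^{c'}` for `|x| ≥ 2`).

## References

* S. Arora, B. Barak, *Computational Complexity: A Modern Approach*, CUP 2009, §8.3 (proof of
  Thm. 8.19, first paragraph), §8.2.1, Def. 2.7.
* L. Babai, S. Moran, *Arthur–Merlin games: a randomized proof system, and a hierarchy of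
  complexity classes*, JCSS 36 (1988), §2.5 (simulations with the old referee as an oracle).
-/

noncomputable section

namespace Literature.Computability.Complexity

open _root_.Computability Finset AMPlayer Brick Plumb Polynomial HashBricks

open scoped Classical Notation

/-! ### Output length of `FP` functions (local copy of a four-line lemma) -/

/-- An `FP` function has polynomially bounded output length (twin of
`exists_poly_length_le_of_mem_FP`, `CountingHierarchyProofs.lean`, not imported here).
[cite: AroraBarakCC2009, §1.3] -/
private theorem exists_poly_length_le {f : List Bool → List Bool} (hf : f ∈ FP) :
    ∃ q : Polynomial ℕ, ∀ x, (f x).length ≤ q.eval x.length := by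
  obtain ⟨p, M, hM⟩ := hf
  refine ⟨X + C (TM2Comp.machinePushBound M.tm) * p, fun x => ?_⟩
  have h := (hM x).length_le
  simpa using h

/-- Absorbing a polynomial into a power: `q(n) ≤ n^e` for all `n ≥ 2`, for some `e ≥ 1`. [folklore] -/
theorem exists_pow_bound (q : Polynomial ℕ) : ∃ e : ℕ, 1 ≤ e ∧ ∀ n : ℕ, 2 ≤ n → q.eval n ≤ n ^ e := by
  obtain ⟨a, b, hab⟩ := exists_eval_le_mul_pow_add q
  -- `a n^b + a ≤ 2a n^b ≤ 2^a n^b ≤ n^(a+b)`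
  refine ⟨a + b + 1, by omega, fun n hn => (hab n).trans ?_⟩
  have h1 : 1 ≤ n ^ b := Nat.one_le_pow _ _ (by omega)
  have h2 : a ≤ 2 ^ a := Nat.lt_two_pow_self.le
  have h3 : 2 ^ a ≤ n ^ a := Nat.pow_le_pow_left hn a
  calc a * n ^ b + a ≤ a * n ^ b + a * n ^ b := by nlinarith
    _ = 2 * (a * n ^ b) := by ring
    _ ≤ n * (n ^ a * n ^ b) := Nat.mul_le_mul hn (Nat.mul_le_mul_right _ (h2.trans h3))
    _ = n ^ (a + b + 1) := by rw [pow_add, pow_add, pow_one]; ring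

/-- Evaluation of an `ℕ`-polynomial is monotone. [folklore] -/
theorem eval_mono_nat (q : Polynomial ℕ) {a b : ℕ} (h : a ≤ b) : q.eval a ≤ q.eval b := by
  rw [eval_eq_sum_range, eval_eq_sum_range]
  exact sum_le_sum fun i _ => Nat.mul_le_mul_left _ (Nat.pow_le_pow_left h i)

/-! ### Game values: dummy moves and cut moves -/

/-- An alternating pattern of length `a + b` starts with the pattern of length `a`. [folklore] -/
theorem exists_alternate_add (p : AMPlayer) (a b : ℕ) : ∃ pat₂ : List AMPlayer, p.alternate (a + b) = p.alternate a ++ pat₂ := by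
  induction a generalizing p with
  | zero => exact ⟨p.alternate b, by simp⟩
  | succ a ih =>
    obtain ⟨pat₂, h⟩ := ih p.other
    exact ⟨pat₂, by rw [Nat.succ_add, AMPlayer.alternate_succ, AMPlayer.alternate_succ, h, List.cons_append]⟩

/-- `bernoulliProb` of "board `0` wins" on one board is the winning probability of that board.
[folklore] -/
theorem bernoulliProb_one (v : Fin 1 → ℝ) : bernoulliProb (fun b : Fin 1 → Bool => b 0 = true) v = v 0 := by
  unfold bernoulliProb bernoulliWeight
  rw [Fintype.sum_eq_single (fun _ : Fin 1 => true)]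
  · simp
  · intro b hb
    have hb0 : b 0 = false := by
      by_contra h
      apply hb; funext i; rw [Subsingleton.elim i 0]; simpa using h
    simp [hb0]

/-- "Board `0` wins" is an up-closed event. [folklore] -/
theorem monotone_board_zero : Monotone fun b : Fin 1 → Bool => b 0 = true :=
  fun _ _ hbc h => by have := hbc 0; rw [h] at this; exact top_le_iff.1 this

/-- **The value of the padded-and-cut game.** Playing `K' ≥ k` moves of length `M' ≥ mh` with a
referee that reads only the first `k` moves, each cut to `mh` bits, and then runs the old referee
`Ref` on input `y`, gives exactly the value of the old game (`k` moves of length `mh`).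
[cite: BabaiMoran1988, §2.5–2.6] -/
theorem gameValue_cut_eq_amValue (Ref : Language Bool) (y : List Bool) {k K' mh M' : ℕ} (hk : k ≤ K') (hmh : mh ≤ M') :
    gameValue (fun H => refereePayoff Ref y ((H.take k).map fun W => W.take mh)) M' (arthur.alternate K') [] =
      amValue Ref mh (arthur.alternate k) y := by
  obtain ⟨e, rfl⟩ := Nat.exists_eq_add_of_le hk
  obtain ⟨pat₂, hpat⟩ := exists_alternate_add arthur k e
  rw [hpat, gameValue_append_dummy _ (fun H => refereePayoff Ref y (H.map fun W => W.take mh)) M' _ _ (fun H C hH _ _ => by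
    simp only [AMPlayer.length_alternate] at hH
    show refereePayoff Ref y (((H ++ C).take k).map fun W => W.take mh) = refereePayoff Ref y (H.map fun W => W.take mh)
    rw [List.take_left' hH])]
  -- one board: the parallel-play lemma with `s = 1`
  have hsplit := isBoardSplit_block_of_le (s := 1) (m := mh) (M := M') (by rwa [one_mul])
  have hpar := gameValue_parallel hsplit (by rwa [one_mul]) monotone_board_zero (refereePayoff_mem_Icc Ref y)
    (fun H => refereePayoff Ref y (H.map fun W => W.take mh)) (arthur.alternate k) [] (fun _ => [])
    (fun C _ _ => by
      rw [List.nil_append, show (fun j : Fin 1 => refereePayoff Ref y ([] ++ C.map (block mh ↑j))) =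
          fun j => if (fun _ : Fin 1 => decide (boolPair y (encMoves (C.map fun W => W.take mh)) ∈ Ref)) j then 1 else 0 from ?_,
        bernoulliProb_indicator]
      · simp only [decide_eq_true_eq, refereePayoff_eq_ite]
      · funext j
        have hb : block mh (↑j : ℕ) = fun W : List Bool => W.take mh := by
          funext W; rw [Subsingleton.elim j 0]; simp [block]
        simp only [List.nil_append, hb, refereePayoff_eq_ite, decide_eq_true_eq])
  rw [hpar, bernoulliProb_one]
  rfl

/-! ### A finite table, as a one-bit brick -/

namespace Brick

/-- **Membership in an explicit finite list of strings**, one bit: `[w ∈ l]`. [folklore] -/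
def memListFn : List (List Bool) → List Bool → List Bool
  | [] => fun _ => [false]
  | s :: l => orFn (eqPairFn ∘ fanoutFn id fun _ => s) (memListFn l)

/-- Value of `memListFn`. [folklore] -/
theorem memListFn_apply : ∀ (l : List (List Bool)) (w : List Bool), memListFn l w = [decide (w ∈ l)]
  | [], w => by simp [memListFn]
  | s :: l, w => by
    rw [memListFn, orFn_apply (b := decide (w = s)) (b' := decide (w ∈ l)) (by simp [eqPairFn_boolPair]) (memListFn_apply l w)]
    simp [List.mem_cons]

/-- `memListFn l` is one-bit. [folklore] -/
theorem oneBit_memListFn (l : List (List Bool)) : OneBit (memListFn l) := fun w => ⟨_, memListFn_apply l w⟩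

/-- `memListFn l ∈ FP`. [folklore] -/
theorem memListFn_mem_FP : ∀ l : List (List Bool), memListFn l ∈ FP
  | [] => const_mem_FP _
  | _ :: l => orFn_mem_FP (comp_mem_FP eqPairFn_mem_FP (fanoutFn_mem_FP OracleCompose.id_mem_FP (const_mem_FP _)))
      (memListFn_mem_FP l)

end Brick

/-- Truth of the string-valued indicator of a language. [folklore] -/
theorem encodeBool_boolIndicator_eq_true_iff (L : Language Bool) (u : List Bool) :
    encodeBool (L.boolIndicator u) = [true] ↔ u ∈ L := by
  unfold Set.boolIndicator
  split_ifs with h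
  · exact ⟨fun _ => h, fun _ => rfl⟩
  · refine ⟨fun h' => ?_, fun h' => absurd h' h⟩
    simp [encodeBool] at h'

/-! ### The simulating referee -/

namespace KarpSim

variable (Ref : Language Bool) (f : List Bool → List Bool) (c : ℕ) (m m' : Polynomial ℕ) (tab : List (List Bool))

/-- The reduced instance `y = f x` (from the referee's input `⟨x, enc H⟩`). [folklore] -/
def yF : List Bool → List Bool := f ∘ fstF

/-- `1^k`, `k = |y|^c`: the number of moves fed to the old referee. [folklore] -/
def kU : List Bool → List Bool := polyFn (X ^ c) ∘ yF f

/-- `1^{m(|y|)}`: the old move length. [folklore] -/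
def mhU : List Bool → List Bool := polyFn m ∘ yF f

/-- `1^{2 m'(|x|) + 2}`: the length of the code of one new move inside `encList H`. [folklore] -/
def wU : List Bool → List Bool := polyFn (2 * m' + 2) ∘ fstF

/-- The code of the first `k` moves: the first `k (2 m'(|x|) + 2)` bits of `encList H`. [folklore] -/
def cutF : List Bool → List Bool := takeFn ∘ fanoutFn (umulFn ∘ fanoutFn (kU f c) (wU m')) (sndF ∘ sndF)

/-- The first `k` moves, each cut to `m(|y|)` bits. [folklore] -/
def trF : List Bool → List Bool := Boards.mapTakeF ∘ fanoutFn (mhU f m) (cutF f c m')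

/-- **The input handed to the old referee**: `⟨y, ⟨1^k, encList (cut moves)⟩⟩ = ⟨y, enc (cut moves)⟩`.
[cite: BabaiMoran1988, §2.5] -/
def redF : List Bool → List Bool := fanoutFn (yF f) (fanoutFn (kU f c) (trF f c m m'))

/-- "The input `x` is short" (`|x| < 2`). [folklore] -/
def smallF : List Bool → List Bool := ltLenF ∘ fanoutFn fstF fun _ => [true, true]

/-- **The new referee's test**: short inputs by the table `tab`, long inputs by the old referee on
the reduced instance and the cut moves. [cite: BabaiMoran1988, §2.5] -/
def testF : List Bool → List Bool :=
  iteFn (smallF) (Brick.memListFn tab ∘ fstF) ((fun u => encodeBool (Ref.boolIndicator u)) ∘ redF f c m m')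

/-- **The new referee** (accept iff the test answers `1`). [cite: BabaiMoran1988, §2.5] -/
def refL : Language Bool := (fanoutFn (testF Ref f c m m' tab) fun _ => [true]) ⁻¹' EqPair

/-- Membership in the new referee. [folklore] -/
theorem mem_refL_iff (z : List Bool) : z ∈ refL Ref f c m m' tab ↔ testF Ref f c m m' tab z = [true] := by
  show fanoutFn (testF Ref f c m m' tab) (fun _ => [true]) z ∈ EqPair ↔ _
  rw [fanoutFn_apply, boolPair_mem_EqPair]

variable {Ref f}

/-- `redF ∈ FP` for `f ∈ FP`. [folklore] -/
theorem redF_mem_FP (hf : f ∈ FP) : redF f c m m' ∈ FP := by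
  have hy : yF f ∈ FP := comp_mem_FP hf fstF_mem_FP
  have hk : kU f c ∈ FP := comp_mem_FP (polyFn_mem_FP _) hy
  have hmh : mhU f m ∈ FP := comp_mem_FP (polyFn_mem_FP _) hy
  have hw : wU m' ∈ FP := comp_mem_FP (polyFn_mem_FP _) fstF_mem_FP
  have hcut : cutF f c m' ∈ FP :=
    comp_mem_FP takeFn_mem_FP (fanoutFn_mem_FP (comp_mem_FP umulFn_mem_FP (fanoutFn_mem_FP hk hw))
      (comp_mem_FP sndF_mem_FP sndF_mem_FP))
  have htr : trF f c m m' ∈ FP := comp_mem_FP Boards.mapTakeF_mem_FP (fanoutFn_mem_FP hmh hcut)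
  exact fanoutFn_mem_FP hy (fanoutFn_mem_FP hk htr)

/-- `smallF ∈ FP`. [folklore] -/
theorem smallF_mem_FP : smallF ∈ FP := comp_mem_FP ltLenF_mem_FP (fanoutFn_mem_FP fstF_mem_FP (const_mem_FP _))

/-- Value of `smallF`. [folklore] -/
theorem smallF_apply (z : List Bool) : smallF z = [decide ((fstF z).length < 2)] := by
  simp [smallF]

/-- **The new referee is polynomial-time** (for `Ref ∈ P`, `f ∈ FP`). [cite: BabaiMoran1988, §2.5] -/
theorem refL_mem_P (hRef : Ref ∈ Classes.P) (hf : f ∈ FP) : refL Ref f c m m' tab ∈ Classes.P := by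
  have htest : testF Ref f c m m' tab ∈ FP :=
    iteFn_mem_FP smallF_mem_FP (comp_mem_FP (Brick.memListFn_mem_FP tab) fstF_mem_FP)
      (comp_mem_FP (indicatorFn_mem_FP hRef) (redF_mem_FP c m m' hf))
  exact preimage_mem_P EqPair_mem_P (fanoutFn_mem_FP htest (const_mem_FP [true]))

/-- **The new referee on a short input** decides by the table. [folklore] -/
theorem mem_refL_of_lt {x : List Bool} (hx : x.length < 2) (W : List Bool) :
    boolPair x W ∈ refL Ref f c m m' tab ↔ x ∈ tab := by
  rw [mem_refL_iff]
  unfold testF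
  rw [iteFn_apply (b := true) (by rw [smallF_apply, fstF_boolPair]; simpa using hx)]
  simp [Brick.memListFn_apply]

/-- The code of the first `k` moves of `H` (all of length `M'`) is the first `k (2M' + 2)` bits of
the code of `H`. [folklore] -/
theorem take_encList {H : List (List Bool)} {M' k : ℕ} (hH : ∀ W ∈ H, W.length = M') (hk : k ≤ H.length) :
    (encList H).take (k * (2 * M' + 2)) = encList (H.take k) := by
  conv_lhs => rw [← List.take_append_drop k H, Boards.encList_append]
  have hlen : (encList (H.take k)).length = k * (2 * M' + 2) := by
    rw [length_encList]
    have : ((H.take k).map fun a => 2 * a.length + 2) = (H.take k).map fun _ => 2 * M' + 2 :=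
      List.map_congr_left fun W hW => by rw [hH W (List.mem_of_mem_take hW)]
    rw [this, List.map_const', List.sum_replicate, List.length_take, min_eq_left hk, smul_eq_mul]
  exact List.take_left' hlen

/-- **The new referee on a long input** runs the old referee on the reduced instance and the first
`|f x|^c` moves cut to `m(|f x|)` bits. [cite: BabaiMoran1988, §2.5] -/
theorem mem_refL_of_le {x : List Bool} (hx : 2 ≤ x.length) {H : List (List Bool)} {M' : ℕ} (hH : ∀ W ∈ H, W.length = M')
    (hM' : M' = m'.eval x.length) (hk : (f x).length ^ c ≤ H.length) :
    boolPair x (encMoves H) ∈ refL Ref f c m m' tab ↔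
      boolPair (f x) (encMoves ((H.take ((f x).length ^ c)).map fun W => W.take (m.eval (f x).length))) ∈ Ref := by
  rw [mem_refL_iff]
  unfold testF
  rw [iteFn_apply (b := false) (by rw [smallF_apply, fstF_boolPair]; simp; omega)]
  simp only [Bool.false_eq_true, ↓reduceIte, Function.comp_apply]
  have hred : redF f c m m' (boolPair x (encMoves H)) =
      boolPair (f x) (encMoves ((H.take ((f x).length ^ c)).map fun W => W.take (m.eval (f x).length))) := by
    rw [Boards.encMoves_eq, Boards.encMoves_eq]
    simp only [redF, trF, cutF, kU, mhU, wU, yF, Function.comp_apply, fanoutFn_apply, fstF_boolPair, sndF_boolPair,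
      polyFn_apply, eval_pow, eval_X, umulFn_boolPair, takeFn_boolPair, List.length_replicate, eval_add, eval_mul,
      eval_ofNat]
    rw [← hM', take_encList hH hk, Boards.mapTakeF_apply, List.length_replicate, List.length_map, List.length_take,
      min_eq_left hk]
  rw [hred, encodeBool_boolIndicator_eq_true_iff]

end KarpSim

/-! ### The closure theorem -/

/-- **`AM` with polynomially many moves is closed under Karp reductions**: if `L₁ ≤ₚ L₂` and `L₂`
has an Arthur–Merlin game with `n^c` moves, then `L₁` has one with `n^{c'}` moves for some
`c' ≥ 1`. [cite: BabaiMoran1988, §2.5] [cite: AroraBarakCC2009, §8.3 (proof of Thm. 8.19: "every L ∈ PSPACE is polytime reducible to TQBF")] -/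
theorem AMRounds_pow_of_karpReducible {L₁ L₂ : Language Bool} (hred : L₁ ≤ₚ L₂) {c : ℕ}
    (h₂ : L₂ ∈ AMRounds fun n => n ^ c) : ∃ c' : ℕ, 1 ≤ c' ∧ L₁ ∈ AMRounds fun n => n ^ c' := by
  obtain ⟨f, hf, hL⟩ := polyTimeKarpReducible_iff.1 hred
  obtain ⟨Ref, hRef, m, hRm⟩ := (mem_AMGames_iff.1 h₂ : ∃ Ref ∈ Classes.P, ∃ m : Polynomial ℕ, ∀ x : List Bool,
    (x ∈ L₂ → (2 / 3 : ℝ) ≤ amValue Ref (m.eval x.length) (arthur.alternate (x.length ^ c)) x) ∧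
      (x ∉ L₂ → amValue Ref (m.eval x.length) (arthur.alternate (x.length ^ c)) x ≤ 1 / 3))
  obtain ⟨q, hq⟩ := exists_poly_length_le hf
  obtain ⟨e, he1, he⟩ := exists_pow_bound q
  -- parameters of the new game
  set c' := e * c + 1 with hc'
  set m' : Polynomial ℕ := m.comp q with hm'
  set tab : List (List Bool) := ([[], [false], [true]] : List (List Bool)).filter fun w => w ∈ L₁ with htab
  have hk : ∀ x : List Bool, 2 ≤ x.length → (f x).length ^ c ≤ x.length ^ c' := fun x hx => by
    calc (f x).length ^ c ≤ (x.length ^ e) ^ c := Nat.pow_le_pow_left ((hq x).trans (he _ hx)) c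
      _ = x.length ^ (e * c) := by rw [pow_mul]
      _ ≤ x.length ^ c' := Nat.pow_le_pow_right (by omega) (by omega)
  have hmh : ∀ x : List Bool, m.eval (f x).length ≤ m'.eval x.length := fun x => by
    rw [hm', eval_comp]; exact eval_mono_nat m (hq x)
  refine ⟨c', by omega, mem_AMGames_iff.2 ⟨KarpSim.refL Ref f c m m' tab, KarpSim.refL_mem_P c m m' tab hRef hf, m', fun x => ?_⟩⟩
  by_cases hx : x.length < 2
  · -- short input: the table decides, the game is irrelevant
    have htabx : x ∈ tab ↔ x ∈ L₁ := by
      rw [htab, List.mem_filter, decide_eq_true_iff, and_iff_right_iff_imp]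
      intro _
      rcases x with _ | ⟨b, _ | ⟨b', x⟩⟩
      · simp
      · cases b <;> simp
      · simp at hx
    have hval : amValue (KarpSim.refL Ref f c m m' tab) (m'.eval x.length) (arthur.alternate (x.length ^ c')) x =
        if x ∈ L₁ then 1 else 0 := by
      unfold amValue
      refine gameValue_eq_of_forall_eq _ _ _ [] _ fun C _ _ => ?_
      rw [List.nil_append, refereePayoff_eq_ite]
      simp only [KarpSim.mem_refL_of_lt c m m' tab hx, htabx]
    constructor
    · intro h1; rw [hval, if_pos h1]; norm_num
    · intro h1; rw [hval, if_neg h1]; norm_num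
  · -- long input: the value is the value of the old game on `f x`
    push Not at hx
    have hval : amValue (KarpSim.refL Ref f c m m' tab) (m'.eval x.length) (arthur.alternate (x.length ^ c')) x =
        amValue Ref (m.eval (f x).length) (arthur.alternate ((f x).length ^ c)) (f x) := by
      rw [← gameValue_cut_eq_amValue Ref (f x) (hk x hx) (hmh x)]
      unfold amValue
      refine gameValue_congr_on _ _ _ _ [] fun C hC hW => ?_
      rw [List.nil_append, refereePayoff_eq_ite, refereePayoff_eq_ite,
        KarpSim.mem_refL_of_le c m m' tab hx hW rfl (by rw [hC, AMPlayer.length_alternate]; exact hk x hx)]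
    rw [hval]
    exact ⟨fun h1 => (hRm (f x)).1 ((hL x).1 h1), fun h1 => (hRm (f x)).2 (fun h => h1 ((hL x).2 h))⟩

end Literature.Computability.Complexity

end
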